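import Literature.NumberTheory.LFunctions.Zhang2022.Section8Lemma84LBounds
import Literature.NumberTheory.LFunctions.Zhang2022.Section8Lemma84Core
import HarnessLib

/-!
# Zhang (2022), Lemma 8.4 — VIII: the size of the continued integrand `Φ` on the pieces of the contour

Topic `Literature/NumberTheory/LFunctions/Zhang2022` (Landau–Siegel audit tree; verdict-neutral).
Y. Zhang, *Discrete mean estimates and the Landau–Siegel zero*, arXiv:2211.02515v1 (2022)
[Zhang2022LandauSiegel] — **an unrefereed manuscript under adjudication**; DAG node `Z22:Lem8.4.pf`
[Z22 p.46–47, tex L2399–2418]: "The contour of integration is moved in the same way as in the proof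
of Lemma 8.2." In the variable `u = s + β_μ` the integrand of (8.9) is `e^{uL}Φ(u)/u²` with
`Φ(u) = 𝔲(w)L(w+β_a,χ)L(w+β_b,χ)/L(w,χ)`, `w = 1 − β_μ + u` (Lemma 8.3). This file PROVES the three
pointwise bounds for `Φ` the contour argument needs, for an ARBITRARY continuation `U` (playing
`𝔲_j(d,r;·)`) bounded by `M_U` on `Re w ≥ 1 − η`, purely imaginary shifts of modulus `≤ 1`, an
`L`-function bound `B_L` on `Re s ≥ 1 − η, |s| ≤ T′ + 4`, and a zero-free package
"`‖L(s,χ)⁻¹‖ ≤ M_inv(1 + |s − ρ|⁻¹)` for `Re s ≥ 1 − 2η`, `|Im s| ≤ T′ + 1`, `s ≠ ρ`" (MV Thm 11.4):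

* `norm_Phi_right_le` — `Re u ≥ α`: `‖Φ(u)‖ ≤ M_U((1+α)/α)³` (trivial bounds right of `σ = 1`);
* `norm_Phi_left_le` — `u = −η + it`, `|t| ≤ T′`, `ρ ≥ 1 − η/2`: `‖Φ(u)‖ ≤ M_U B_L² M_inv(1 + 2/η)`;
* `norm_Phi_horiz_le` — `u = x ± iT′`, `−η ≤ x ≤ α ≤ 1`, `T′ ≥ 2`: `‖Φ(u)‖ ≤ 3M_U B_L² M_inv`;
* `LFunction_ne_zero_near` — `L(w,χ) ≠ 0` for `u` in the box off `u₁ = ρ − 1 + β_μ`.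

Nothing about the manuscript's Theorems 1–2 or about Landau–Siegel zeros is asserted.

## References

* Y. Zhang, arXiv:2211.02515v1 (2022), §8 Lemma 8.4 (proof), Lemma 8.3, Lemma 5.5.
  [cite: Zhang2022LandauSiegel, §8 Lemma 8.4]
* H. L. Montgomery, R. C. Vaughan, *Multiplicative Number Theory I*, CUP 2007, Thm 11.4, §6.2.
  [cite: MontgomeryVaughan2007, Thm 11.4]
-/

noncomputable section

open Complex Real

namespace Literature.NumberTheory.LFunctions.Zhang2022.Lemma84

section PhiBounds

variable {D : ℕ} [NeZero D] (χ : DirichletCharacter ℂ D)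
variable (U Φ : ℂ → ℂ) (βμ βa βb : ℂ) {ρ η α T' MU BL Minv : ℝ}

/-- The point `w = 1 − β_μ + u`: real part `1 + Re u`, imaginary part `Im u − Im β_μ` (`Re β_μ = 0`).
[cite: Zhang2022LandauSiegel, §8 (8.9)] -/
theorem w_re_im (hβμ : βμ.re = 0) (u : ℂ) :
    (1 - βμ + u).re = 1 + u.re ∧ (1 - βμ + u).im = u.im - βμ.im := by
  constructor
  · simp [hβμ]
  · simp; ring

/-- Size of `w + β = 1 − β_μ + u + β` when `|Re u| ≤ 1`, `|Im u| ≤ T′`, `‖β_μ‖, ‖β‖ ≤ 1`: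
`‖w + β‖ ≤ T′ + 4`, and `Re(w + β) = 1 + Re u` for `β` purely imaginary.
[cite: Zhang2022LandauSiegel, §8 Lemma 8.4 (proof)] -/
theorem norm_w_add_le (hβμ1 : ‖βμ‖ ≤ 1) {β : ℂ} (hβ : β.re = 0) (hβ1 : ‖β‖ ≤ 1) (hβμ : βμ.re = 0)
    {u : ℂ} (hre : |u.re| ≤ 1) (him : |u.im| ≤ T') :
    ‖1 - βμ + u + β‖ ≤ T' + 4 ∧ (1 - βμ + u + β).re = 1 + u.re := by
  constructor
  · have hu : ‖u‖ ≤ 1 + T' := (Complex.norm_le_abs_re_add_abs_im u).trans (by linarith)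
    calc ‖1 - βμ + u + β‖ ≤ ‖1 - βμ + u‖ + ‖β‖ := norm_add_le _ _
      _ ≤ (‖(1 : ℂ) - βμ‖ + ‖u‖) + ‖β‖ := by gcongr; exact norm_add_le _ _
      _ ≤ ((‖(1 : ℂ)‖ + ‖βμ‖) + ‖u‖) + ‖β‖ := by gcongr; exact norm_sub_le _ _
      _ ≤ ((1 + 1) + (1 + T')) + 1 := by rw [norm_one]; gcongr
      _ = T' + 4 := by ring
  · simp [hβμ, hβ]

/-- **`Φ` to the right of `Re u = α`**: if `‖U(w)‖ ≤ M_U` for `Re w ≥ 1 + α` then for `Re u ≥ α`,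
`‖Φ(u)‖ ≤ M_U((1+α)/α)³` (`|L(s,χ)|, |L(s,χ)|⁻¹ ≤ (1+α)/α` for `Re s ≥ 1 + α`).
[cite: Zhang2022LandauSiegel, §8 Lemma 8.4 (proof)] [cite: MontgomeryVaughan2007, Lemma 11.1] -/
theorem norm_Phi_right_le (hα : 0 < α) (hβμ : βμ.re = 0) (hβa : βa.re = 0) (hβb : βb.re = 0)
    (hΦ : ∀ u, Φ u = U (1 - βμ + u) * χ.LFunction (1 - βμ + u + βa) *
      χ.LFunction (1 - βμ + u + βb) / χ.LFunction (1 - βμ + u))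
    (hMU : 0 ≤ MU) (hU : ∀ w : ℂ, 1 + α ≤ w.re → ‖U w‖ ≤ MU) {u : ℂ} (hu : α ≤ u.re) :
    χ.LFunction (1 - βμ + u) ≠ 0 ∧ ‖Φ u‖ ≤ MU * ((1 + α) / α) ^ 3 := by
  obtain ⟨hwre, -⟩ := w_re_im βμ hβμ u
  have hw : 1 + α ≤ (1 - βμ + u).re := by rw [hwre]; linarith
  have hwa : 1 + α ≤ (1 - βμ + u + βa).re := by simp only [add_re, hβa, add_zero] at hw ⊢; exact hw
  have hwb : 1 + α ≤ (1 - βμ + u + βb).re := by simp only [add_re, hβb, add_zero] at hw ⊢; exact hw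
  have ha := norm_LFunction_le_right' χ hα hwa
  have hb := norm_LFunction_le_right' χ hα hwb
  obtain ⟨hne, hinv⟩ := inv_LFunction_le_right χ hα hw
  refine ⟨hne, ?_⟩
  rw [hΦ u]
  have hB : 0 ≤ (1 + α) / α := by positivity
  calc _ ≤ MU * ((1 + α) / α) * ((1 + α) / α) * ((1 + α) / α) :=
        norm_quot_le hMU hB (hU _ hw) ha hb hinv
    _ = MU * ((1 + α) / α) ^ 3 := by ring

/-- **`L(w,χ) ≠ 0` near the contour, off the exceptional point.** If `L(s,χ) ≠ 0` for
`Re s ≥ 1 − 2η`, `|Im s| ≤ T′ + 1`, `s ≠ ρ` (the zero-free package), then for `u` with `Re u ≥ −2η`,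
`|Im u| ≤ T′ + 1/2`, `u ≠ u₁ = ρ − 1 + β_μ` (`‖β_μ‖ ≤ 1/2`): `L(1 − β_μ + u, χ) ≠ 0`.
[cite: Zhang2022LandauSiegel, §5 Lemma 5.5] [cite: MontgomeryVaughan2007, Thm 11.4] -/
theorem LFunction_ne_zero_near (hβμ : βμ.re = 0) (hβμ1 : ‖βμ‖ ≤ 1 / 2)
    (hzf : ∀ s : ℂ, 1 - 2 * η ≤ s.re → |s.im| ≤ T' + 1 → s ≠ (ρ : ℂ) → χ.LFunction s ≠ 0)
    {u : ℂ} (hre : -(2 * η) ≤ u.re) (him : |u.im| ≤ T' + 1 / 2)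
    (hne : u ≠ ((ρ - 1 : ℝ) : ℂ) + βμ) : χ.LFunction (1 - βμ + u) ≠ 0 := by
  obtain ⟨hwre, hwim⟩ := w_re_im βμ hβμ u
  refine hzf _ (by rw [hwre]; linarith) ?_ ?_
  · rw [hwim]
    have h1 := abs_sub u.im βμ.im
    have h2 : |βμ.im| ≤ 1 / 2 := (Complex.abs_im_le_norm βμ).trans hβμ1
    linarith
  · intro h
    apply hne
    have : u = (ρ : ℂ) - 1 + βμ := by rw [← h]; ring
    rw [this]; push_cast; ring

/-- **`Φ` on the left side `Re u = −η`** (`|t| ≤ T′`): with `‖U(w)‖ ≤ M_U` on `Re w ≥ 1 − η`,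
`‖L(s,χ)‖ ≤ B_L` for `Re s ≥ 1 − η`, `|s| ≤ T′ + 4`, the zero-free package
`‖L(s,χ)⁻¹‖ ≤ M_inv(1 + |s−ρ|⁻¹)` (`Re s ≥ 1 − 2η`, `|Im s| ≤ T′ + 1`, `s ≠ ρ`) and `ρ ≥ 1 − η/2`:
`‖Φ(−η + it)‖ ≤ M_U B_L² M_inv (1 + 2/η)` (`|w − ρ| ≥ ρ − (1 − η) ≥ η/2`).
[cite: Zhang2022LandauSiegel, §8 Lemma 8.4 (proof)] [cite: MontgomeryVaughan2007, Thm 11.4] -/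
theorem norm_Phi_left_le (hη : 0 < η) (hη1 : η ≤ 1) (hβμ : βμ.re = 0) (hβμ1 : ‖βμ‖ ≤ 1 / 2)
    (hβa : βa.re = 0) (hβa1 : ‖βa‖ ≤ 1) (hβb : βb.re = 0) (hβb1 : ‖βb‖ ≤ 1)
    (hΦ : ∀ u, Φ u = U (1 - βμ + u) * χ.LFunction (1 - βμ + u + βa) *
      χ.LFunction (1 - βμ + u + βb) / χ.LFunction (1 - βμ + u))
    (hMU : 0 ≤ MU) (hU : ∀ w : ℂ, 1 - η ≤ w.re → ‖U w‖ ≤ MU) (hBL : 0 ≤ BL)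
    (hL : ∀ s : ℂ, 1 - η ≤ s.re → ‖s‖ ≤ T' + 4 → ‖χ.LFunction s‖ ≤ BL) (hMinv : 0 ≤ Minv)
    (hpack : ∀ s : ℂ, 1 - 2 * η ≤ s.re → |s.im| ≤ T' + 1 → s ≠ (ρ : ℂ) →
      χ.LFunction s ≠ 0 ∧ ‖(χ.LFunction s)⁻¹‖ ≤ Minv * (1 + ‖s - ρ‖⁻¹))
    (hρ : 1 - η / 2 ≤ ρ) {t : ℝ} (ht : |t| ≤ T') :
    ‖Φ (((-η : ℝ) : ℂ) + t * I)‖ ≤ MU * BL * BL * (Minv * (1 + 2 / η)) := by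
  set u : ℂ := ((-η : ℝ) : ℂ) + t * I with hu
  have hure : u.re = -η := by simp [hu]
  have huim : u.im = t := by simp [hu]
  obtain ⟨hwre, hwim⟩ := w_re_im βμ hβμ u
  have hβμ1' : ‖βμ‖ ≤ 1 := by linarith
  have hre1 : |u.re| ≤ 1 := by rw [hure, abs_neg, abs_of_pos hη]; exact hη1
  have him : |u.im| ≤ T' := by rw [huim]; exact ht
  obtain ⟨hna, hrea⟩ := norm_w_add_le βμ hβμ1' hβa hβa1 hβμ hre1 him
  obtain ⟨hnb, hreb⟩ := norm_w_add_le βμ hβμ1' hβb hβb1 hβμ hre1 him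
  have ha := hL _ (by rw [hrea, hure]; linarith) hna
  have hb := hL _ (by rw [hreb, hure]; linarith) hnb
  have hUw := hU _ (by rw [hwre, hure]; linarith)
  -- the zero-free package at `w`
  have hwρ : η / 2 ≤ ‖(1 - βμ + u) - ρ‖ := by
    have h1 : |((1 - βμ + u) - ρ).re| ≤ ‖(1 - βμ + u) - ρ‖ := Complex.abs_re_le_norm _
    have h2 : ((1 - βμ + u) - ρ).re = 1 - η - ρ := by
      rw [sub_re, hwre, hure, Complex.ofReal_re]; ring
    rw [h2] at h1
    have h3 : η / 2 ≤ |1 - η - ρ| := by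
      rw [abs_of_nonpos (by linarith)]; linarith
    exact h3.trans h1
  have hwne : (1 - βμ + u) ≠ (ρ : ℂ) := by
    intro h
    rw [h, sub_self, norm_zero] at hwρ
    linarith
  have hwim' : |(1 - βμ + u).im| ≤ T' + 1 := by
    rw [hwim, huim]
    have h1 := abs_sub t βμ.im
    have h2 : |βμ.im| ≤ 1 / 2 := (Complex.abs_im_le_norm βμ).trans hβμ1
    linarith
  obtain ⟨-, hinv⟩ := hpack _ (by rw [hwre, hure]; linarith) hwim' hwne
  have hinv' : ‖(χ.LFunction (1 - βμ + u))⁻¹‖ ≤ Minv * (1 + 2 / η) := by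
    refine hinv.trans (mul_le_mul_of_nonneg_left ?_ hMinv)
    have : ‖(1 - βμ + u) - ρ‖⁻¹ ≤ 2 / η := by
      rw [inv_le_comm₀ (lt_of_lt_of_le (by positivity) hwρ) (by positivity), inv_div]
      exact hwρ
    linarith
  rw [hΦ u]
  exact norm_quot_le hMU hBL hUw ha hb hinv'

/-- **`Φ` on the horizontal sides `Im u = ±T′`** (`−η ≤ Re u ≤ α ≤ 1`, `T′ ≥ 2`): with the same
data, `‖Φ(x ± iT′)‖ ≤ 3 M_U B_L² M_inv` (`|w − ρ| ≥ |Im w| ≥ T′ − 1/2 ≥ 1/2`).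
[cite: Zhang2022LandauSiegel, §8 Lemma 8.4 (proof)] [cite: MontgomeryVaughan2007, Thm 11.4] -/
theorem norm_Phi_horiz_le (hη : 0 < η) (hη1 : η ≤ 1) (hα1 : α ≤ 1) (hT : 2 ≤ T')
    (hβμ : βμ.re = 0) (hβμ1 : ‖βμ‖ ≤ 1 / 2)
    (hβa : βa.re = 0) (hβa1 : ‖βa‖ ≤ 1) (hβb : βb.re = 0) (hβb1 : ‖βb‖ ≤ 1)
    (hΦ : ∀ u, Φ u = U (1 - βμ + u) * χ.LFunction (1 - βμ + u + βa) *
      χ.LFunction (1 - βμ + u + βb) / χ.LFunction (1 - βμ + u))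
    (hMU : 0 ≤ MU) (hU : ∀ w : ℂ, 1 - η ≤ w.re → ‖U w‖ ≤ MU) (hBL : 0 ≤ BL)
    (hL : ∀ s : ℂ, 1 - η ≤ s.re → ‖s‖ ≤ T' + 4 → ‖χ.LFunction s‖ ≤ BL) (hMinv : 0 ≤ Minv)
    (hpack : ∀ s : ℂ, 1 - 2 * η ≤ s.re → |s.im| ≤ T' + 1 → s ≠ (ρ : ℂ) →
      χ.LFunction s ≠ 0 ∧ ‖(χ.LFunction s)⁻¹‖ ≤ Minv * (1 + ‖s - ρ‖⁻¹))
    {x y : ℝ} (hx1 : -η ≤ x) (hx2 : x ≤ α) (hy : |y| = T') :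
    ‖Φ ((x : ℂ) + y * I)‖ ≤ MU * BL * BL * (Minv * 3) := by
  set u : ℂ := (x : ℂ) + y * I with hu
  have hure : u.re = x := by simp [hu]
  have huim : u.im = y := by simp [hu]
  obtain ⟨hwre, hwim⟩ := w_re_im βμ hβμ u
  have hβμ1' : ‖βμ‖ ≤ 1 := by linarith
  have hre1 : |u.re| ≤ 1 := by rw [hure, abs_le]; constructor <;> linarith
  have him : |u.im| ≤ T' := by rw [huim, hy]
  obtain ⟨hna, hrea⟩ := norm_w_add_le βμ hβμ1' hβa hβa1 hβμ hre1 him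
  obtain ⟨hnb, hreb⟩ := norm_w_add_le βμ hβμ1' hβb hβb1 hβμ hre1 him
  have ha := hL _ (by rw [hrea, hure]; linarith) hna
  have hb := hL _ (by rw [hreb, hure]; linarith) hnb
  have hUw := hU _ (by rw [hwre, hure]; linarith)
  have hβim : |βμ.im| ≤ 1 / 2 := (Complex.abs_im_le_norm βμ).trans hβμ1
  -- the zero-free package at `w`
  have hwρ : 1 / 2 ≤ ‖(1 - βμ + u) - ρ‖ := by
    have h1 : |((1 - βμ + u) - ρ).im| ≤ ‖(1 - βμ + u) - ρ‖ := Complex.abs_im_le_norm _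
    have h2 : ((1 - βμ + u) - ρ).im = y - βμ.im := by
      rw [sub_im, hwim, huim, Complex.ofReal_im]; ring
    rw [h2] at h1
    have h3 := abs_sub_abs_le_abs_sub y βμ.im
    rw [hy] at h3
    linarith
  have hwne : (1 - βμ + u) ≠ (ρ : ℂ) := by
    intro h
    rw [h, sub_self, norm_zero] at hwρ
    linarith
  have hwim' : |(1 - βμ + u).im| ≤ T' + 1 := by
    rw [hwim, huim]
    have h1 := abs_sub y βμ.im
    rw [hy] at h1
    linarith
  obtain ⟨-, hinv⟩ := hpack _ (by rw [hwre, hure]; linarith) hwim' hwne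
  have hinv' : ‖(χ.LFunction (1 - βμ + u))⁻¹‖ ≤ Minv * 3 := by
    refine hinv.trans (mul_le_mul_of_nonneg_left ?_ hMinv)
    have : ‖(1 - βμ + u) - ρ‖⁻¹ ≤ 2 := by
      rw [inv_le_comm₀ (lt_of_lt_of_le (by positivity) hwρ) (by positivity)]
      linarith
    linarith
  rw [hΦ u]
  exact norm_quot_le hMU hBL hUw ha hb hinv'

end PhiBounds

end Literature.NumberTheory.LFunctions.Zhang2022.Lemma84
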